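import Summits.AtomisticToContinuum.Crystallization.Theorems.BraggSlacknessRigidityStrictCertificateDesign
import Summits.AtomisticToContinuum.Crystallization.Theorems.BraggSlacknessRigidityStrictCertificateStubHcpPeriodicMinimum

/-!
# Crux `StrictCertificate` (stmt-AtomisticToContinuum-13167, route `BraggSlacknessRigidity`, rank 3) —
# skeleton v2 of line `registered` (= birth skeleton `Lines/birth.lean`, lead c3, 2026-08-17)

The crux (FQ name `Summit.AtomisticToContinuum.Crystallization.Theses.BraggSlacknessRigidity.StrictCertificate`):
Lennard-Jones admits an EXACT zero-pressure three-cone split `V_LJ = g + U + f` on `(0,∞)` at an hcp TEMPLATE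
`P = hcpPeriodicConfiguration a h` which is STRICT (14 conjuncts; see the route file).

## v2 = v1 with the glue LANDED.  Same two registered stubs, same composition idea; the composition
`strictCertificate_of_stubs : stub₁-sig → stub₂-sig → StrictCertificate` (with `posType_of_fourier`,
`continuousOn_of_radial`, `isSplit_of_design`, `strictCertificate_of_design`) is now the tree theorem
`Theorems/BraggSlacknessRigidityStrictCertificateDesign.lean` (p146257), which ALSO proves the converse
bookkeeping: `strictCertificate_iff_exists_design` (the crux IS "some hcp template carries a strict design"),
`hcpPeriodicMinimum_of_strictCertificate` (**stub₁ is NECESSARY** for the crux), `hcpPeriodicMinimum_of_design`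
(a strict design FORCES its template to be a periodic minimiser — the minimality hypothesis of stub₂ only
restricts where a design is asked for), `crysPeriodicMinAttained_of_strictCertificate` (crux → item 0627's
signature) and `keplerBound_of_strictCertificate` (crux → item 11961).  The reductions for stub₁ are the tree
theorem `Theorems/BraggSlacknessRigidityStrictCertificateStubHcpPeriodicMinimum.lean` (p146258): item 3061
`HcpPeriodicMinimiser` → stub₁ → item 0627 / KeplerBound / conjunct (i).

## Status of the stubs (honest)
* `stub_hcpPeriodicMinimum` — OPEN = item stmt-AtomisticToContinuum-3061 without its box on `(a,h)` ⊇ item 0627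
  (the attained-minimum half of conjunct (i); Blanc–Lewin 2015 §2.3, open in d = 3).  `blocked-on 3061`.
* `stub_strictDesign` — OPEN; at a template it is the crux itself (`strictCertificate_iff_exists_design`), i.e. the
  far-field wall W1 (one-sided radial Fourier interpolation with `𝓕F ≥ 0` vanishing on the non-extinct Bragg spheres,
  supercritical in d = 3; sibling dossier `Cruxes/ExactCertificate/STRATEGY-CENSUS.md` §0, §3 S⁺₁) plus the charged
  core bound; expected FALSE at hcp by that census, no catalogued non-interpolation theorem either way.

## Audit (this file, `lean check --json`): rc 0, errors 0, sorries 2 = the two `stub_*`; `strictCertificate_of_stubs`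
concludes the ROUTE DECL by name.
-/

noncomputable section

namespace Summit.AtomisticToContinuum.Crystallization.Cruxes.StrictCertificate.Birth

open Summit.AtomisticToContinuum.Crystallization.Theorems.BraggSlacknessRigidityStrictCertificate
  (strictCertificate_of_design)

/-! ## The two registered stubs (signatures unchanged since registration c3d1d84b…) -/

/-- **stub_hcpPeriodicMinimum — TEMPLATE IDENTIFICATION (open; = item 3061 without the box; ⊇ item 0627).**
Some hexagonal close packing `hcp(a,h)` (both parameters relaxed) minimises the Lennard-Jones energy per particle
among ALL periodic configurations of `ℝ³`.  NECESSARY for the crux (`hcpPeriodicMinimum_of_strictCertificate`);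
discharged by item 3061 (`stub_hcpPeriodicMinimum_of_hcpPeriodicMinimiser`). -/
theorem stub_hcpPeriodicMinimum : ∃ (a h : ℝ) (ha : a ≠ 0) (hh : h ≠ 0), ∀ Q : Literature.MathematicalPhysics.StatisticalMechanics.PeriodicConfiguration 3, (Literature.MathematicalPhysics.StatisticalMechanics.hcpPeriodicConfiguration ha hh).energyPerParticle Literature.MathematicalPhysics.StatisticalMechanics.lennardJones ≤ Q.energyPerParticle Literature.MathematicalPhysics.StatisticalMechanics.lennardJones := by
  sorry

/-- **stub_strictDesign — STRICT DESIGN IN PERIODIC NORMAL FORM at every periodic-minimising hcp template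
(open-problem; the hardest stub; at a template it is equivalent to the crux there, `strictCertificate_iff_exists_design`).**
See v1 (`Lines/birth.lean` history) and `Theorems/BraggSlacknessRigidityStrictCertificateDesign.lean` for the
conjunct-by-conjunct reading. -/
theorem stub_strictDesign : ∀ (a h : ℝ) (ha : a ≠ 0) (hh : h ≠ 0), (∀ Q : Literature.MathematicalPhysics.StatisticalMechanics.PeriodicConfiguration 3, (Literature.MathematicalPhysics.StatisticalMechanics.hcpPeriodicConfiguration ha hh).energyPerParticle Literature.MathematicalPhysics.StatisticalMechanics.lennardJones ≤ Q.energyPerParticle Literature.MathematicalPhysics.StatisticalMechanics.lennardJones) → ∃ (ρ : ℝ) (f Uc : ℝ → ℝ), 0 < ρ ∧ Continuous (fun v : EuclideanSpace ℝ (Fin 3) => (f ‖v‖ : ℂ)) ∧ MeasureTheory.Integrable (fun v : EuclideanSpace ℝ (Fin 3) => (f ‖v‖ : ℂ)) ∧ MeasureTheory.Integrable (FourierTransform.fourier (fun v : EuclideanSpace ℝ (Fin 3) => (f ‖v‖ : ℂ))) ∧ (∀ ξ : EuclideanSpace ℝ (Fin 3), (FourierTransform.fourier (fun v : EuclideanSpace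 ℝ (Fin 3) => (f ‖v‖ : ℂ)) ξ).im = 0 ∧ 0 ≤ (FourierTransform.fourier (fun v : EuclideanSpace ℝ (Fin 3) => (f ‖v‖ : ℂ)) ξ).re) ∧ (∀ ξ : EuclideanSpace ℝ (Fin 3), ξ ≠ 0 → (∀ k : EuclideanSpace ℝ (Fin 3), (∀ g ∈ (Literature.MathematicalPhysics.StatisticalMechanics.hcpPeriodicConfiguration ha hh).lattice, ∃ n : ℤ, inner ℝ k g = (n : ℝ)) → ‖ξ‖ ≠ ‖k‖) → FourierTransform.fourier (fun v : EuclideanSpace ℝ (Fin 3) => (f ‖v‖ : ℂ)) ξ ≠ 0) ∧ (∀ r : ℝ, ρ ≤ r → f r ≤ Literature.MathematicalPhysics.StatisticalMechanics.lennardJones r) ∧ (∀ r : ℝ, ρ ≤ r → f r = Literature.MathematicalPhysics.StatisticalMechanics.lennardJones r → ∃ p ∈ (Literature.MathematicalPhysics.StatisticalMechanics.hcpPeriodicConfiguration ha hh).points, ∃ q ∈ (Literature.MathematicalPhysics.StatisticalMechanics.hcpPeriodicConfiguration ha hh).points, r = dist p q) ∧ ContinuousOn Uc (Set.Ioc 0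 ρ) ∧ (∀ r : ℝ, 0 < r → r < ρ → 0 ≤ Uc r) ∧ (∀ r : ℝ, 0 < r → r < ρ → Uc r = 0 → ∃ p ∈ (Literature.MathematicalPhysics.StatisticalMechanics.hcpPeriodicConfiguration ha hh).points, ∃ q ∈ (Literature.MathematicalPhysics.StatisticalMechanics.hcpPeriodicConfiguration ha hh).points, r = dist p q) ∧ Uc ρ = Literature.MathematicalPhysics.StatisticalMechanics.lennardJones ρ - f ρ ∧ (∀ Q : Literature.MathematicalPhysics.StatisticalMechanics.PeriodicConfiguration 3, (Literature.MathematicalPhysics.StatisticalMechanics.hcpPeriodicConfiguration ha hh).energyPerParticle Literature.MathematicalPhysics.StatisticalMechanics.lennardJones + f 0 / 2 ≤ Q.energyPerParticle (fun r => if r < ρ then Literature.MathematicalPhysics.StatisticalMechanics.lennardJones r - f r - Uc r else 0)) := by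
  sorry

/-! ## Composition (landed glue) -/

/-- The crux `BraggSlacknessRigidity.StrictCertificate` from the two stubs, by the landed composition
`strictCertificate_of_design` (the only `sorry`s in its cone are the two stubs). [folklore] -/
theorem strictCertificate_of_stubs :
    Summit.AtomisticToContinuum.Crystallization.Theses.BraggSlacknessRigidity.StrictCertificate := by
  obtain ⟨a, h, ha, hh, hmin⟩ := stub_hcpPeriodicMinimum
  exact strictCertificate_of_design a h ha hh (stub_strictDesign a h ha hh hmin)

end Summit.AtomisticToContinuum.Crystallization.Cruxes.StrictCertificate.Birth

end
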